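import Summits.Ventures.CertifiedArithmetic.LowPrec.GemmThetaLawMixBFamilyWord
import Summits.Ventures.CertifiedArithmetic.LowPrec.GemmTwoBinadeClimb
import HarnessLib

/-!
# GEMM worst case LV-b — the canonical E3M2·E2M1 family for EVERY precision `p ≥ 11`: an
# explicit all-`n` input whose sequential-RNE relative error is `1 - 8θ_p/(8n - 77312K + 1)`

HONEST FRAMING: certified error envelopes and provably optimal rounding/accumulation schemes for
low-precision formats under stated cost models; every table by two implementations; no hardware or
vendor claims.

The UPPER side of the mixed E3M2·E2M1 θ-law (gemm.tex Thm. `t:thetapmix`, second row),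
symbolically in the precision.  For a format `φ` with `qexp φ ≤ -5`, `2^(manBits φ + 15) ≤
maxRat φ` and `2^manBits = 1024K` (`K = 2^(p-11)`), the family `fam5 K` of file LV-a
(`GemmThetaLawMixBFamilyWord`; every letter a product of an E3M2 and an E2M1 datum) has the
explicit accumulator trajectory `traj5 K` (`fam5_seqSum`): exact sums up to `2·2^manBits` grid
units, every `3/32` is `spacing + tie` resolved up, in binade `j = 1..10` each letter of the pair
`(x_j, 2^j)/32` advances the accumulator by exactly one grid step (`x_j` exceeds the half-spacing
from an even point, `2^j` is a tie from an odd point resolved up), the end pair `(72, 64)` makes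
two more steps to `v° = (1024K+2)·128` (value `2^(p+6) + 2^8`), and every later `-64` is absorbed
(`fam5_tail`: a tie at an odd point, resolved up to the even `v°`).  Prefix `10753K + 2 =
21·2^(p-2) + 2 + 2^(p-11)` letters (the paper's `m_p`), mass `(2230272K + 4352)/32`; hence
(`fam5_relErr`) for every `n ≥ 10753K + 2` the relative error is EXACTLY
`(8n - 78352K - 1)/(8n - 77312K + 1) = 1 - (1040K + 2)/(8n - 77312K + 1)`, `1040K + 2 = 8·θ_p`,
`θ_p = (65·2^manBits + 128)/512 = e3m2e2m1Law.thetaL manBits` (`fam5_defect`).  Method: the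
binade-step lemma `rneSigMag_binade_step` (file XLIX-a), the grid bridge `value_step5`, a
fourteen-way case analysis of the letter index closed by `omega` (`traj5_step`; no `decide` — the
precision is a symbol), then `tieChain_spec` / `tieChain_inRange` for the absorbed tail.  File LVI
(`GemmWorstCaseMixBPrec`): the two-sided sandwich for `W_p(n)` and the limit, every `p ≥ 13`.
References: SUP side `thetaCert_e3m2e2m1Law` (`GemmThetaLawGenFinal`); [Higham2002, §4.2],
[MullerEtAl2018HFPA, §6.1], [BoldoMelquiond2011Flocq], [RouhaniEtAl2023MX, Table 1].
-/

namespace Summit.Ventures.CertifiedArithmetic.LowPrec.Gemm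

open Literature.ComputerArithmetic.FloatingPoint
open Literature.ComputerArithmetic.FloatingPoint.MiniFloat
open Literature.ComputerArithmetic.FloatingPoint.MiniFloat.TieChain (seqSum_orbitFn)
open Finset

variable {φ : Format}

section Steps

variable (hq : φ.qexp ≤ -5) (hR : (2 : ℚ) ^ (φ.manBits + 15) ≤ φ.maxRat)
  {K : ℕ} (hM : 2 ^ φ.manBits = 1024 * K)
include hq hR hM

/-- THE PREFIX ROUNDINGS (fourteen cases of the letter index, each one binade step):
`fl_φ(traj5 k + fam5 (k+1)) = traj5 (k+1)` for every `k ≤ 10753K`, and the step is in range.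
[cell] -/
theorem traj5_step (k : ℕ) (hk : k < 10753 * K + 1) :
    (roundNE φ (traj5 K k + fam5 K (k + 1))).toRat = traj5 K (k + 1) ∧
      |traj5 K k + fam5 K (k + 1)| ≤ φ.maxRat := by
  obtain ⟨hK1, hpow, hpow1⟩ := pow_facts5 hM
  have h2 : 2 ∣ 1024 * K := ⟨512 * K, by ring⟩
  unfold traj5 fam5
  rcases (by omega : k + 2 < K ∨ k + 2 = K ∨ (K ≤ k + 1 ∧ k + 2 ≤ 513 * K) ∨
      (513 * K ≤ k + 1 ∧ k + 2 ≤ 1537 * K) ∨ (1537 * K ≤ k + 1 ∧ k + 2 ≤ 2561 * K) ∨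
      (2561 * K ≤ k + 1 ∧ k + 2 ≤ 3585 * K) ∨ (3585 * K ≤ k + 1 ∧ k + 2 ≤ 4609 * K) ∨
      (4609 * K ≤ k + 1 ∧ k + 2 ≤ 5633 * K) ∨ (5633 * K ≤ k + 1 ∧ k + 2 ≤ 6657 * K) ∨
      (6657 * K ≤ k + 1 ∧ k + 2 ≤ 7681 * K) ∨ (7681 * K ≤ k + 1 ∧ k + 2 ≤ 8705 * K) ∨
      (8705 * K ≤ k + 1 ∧ k + 2 ≤ 9729 * K) ∨ (9729 * K ≤ k + 1 ∧ k + 2 ≤ 10753 * K) ∨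
      (10753 * K ≤ k + 1 ∧ k + 2 ≤ 10753 * K + 2)) with
      h | h | h | h | h | h | h | h | h | h | h | h | h | h
  · -- exact prefix: `2048(k+2) < 2048K = 2^(m+1)`
    refine value_step5 hq hR (n := 2048 * k + 4096) ?_ (by omega) ?_
    · rw [traj5N_P (by omega), fam5Z_P (by omega)]; push_cast; omega
    · rw [traj5N_P (by omega), rneSigMag_of_lt (by rw [hpow1]; omega)]; omega
  · -- the last `64` lands exactly on `2^(m+1) = (1024K + 0)·2 + 0` (binade 0, `r = 0`)
    refine value_step5 hq hR (n := (1024 * K + 0) * 2 + 0) ?_ (by omega) ?_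
    · rw [traj5N_P (by omega), fam5Z_P (by omega)]; push_cast; omega
    · rw [traj5N_P (by omega), rneSigMag_binade_step (j := 0) hM h2 (by norm_num) (by omega)
        (by norm_num)]
      simp [stepUp]; omega
  · -- binade 0, letter `3 = spacing + 1` from an even point: a tie at an odd `t`, resolved up
    refine value_step5 hq hR (n := (1024 * K + (2 * k + 3 - 2 * K)) * 2 + 1) ?_ (by omega) ?_
    · rw [traj5N_B0 (by omega) (by omega), fam5Z_B0 (by omega) (by omega)]; push_cast; omega
    · rw [traj5N_B0 (by omega) (by omega), rneSigMag_binade_step (j := 0) hM h2 (by norm_num)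
        (by omega) (by norm_num)]
      simp [stepUp]; omega
  · obtain ⟨e, he, hek⟩ : ∃ e, e < 1024 * K ∧ k + 1 = 513 * K + e :=  -- binade 1
      ⟨k + 1 - 513 * K, by omega, by omega⟩
    rcases Nat.mod_two_eq_zero_or_one e with hp | hp
    · refine value_step5 hq hR (n := (1024 * K + e) * 4 + 3) ?_ (by omega) ?_
      · rw [traj5N_T1 (by omega) (by omega), hek, fam5Z_B1 K e he, pairZ_even _ _ hp]
        push_cast; omega
      · rw [traj5N_T1 (by omega) (by omega), rneSigMag_binade_step (j := 1) hM h2 (by norm_num)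
          (by omega) (by norm_num)]
        simp [stepUp]; omega
    · refine value_step5 hq hR (n := (1024 * K + e) * 4 + 2) ?_ (by omega) ?_
      · rw [traj5N_T1 (by omega) (by omega), hek, fam5Z_B1 K e he, pairZ_odd _ _ hp]
        push_cast; omega
      · rw [traj5N_T1 (by omega) (by omega), rneSigMag_binade_step (j := 1) hM h2 (by norm_num)
          (by omega) (by norm_num)]
        simp [stepUp]; omega
  · obtain ⟨e, he, hek⟩ : ∃ e, e < 1024 * K ∧ k + 1 = 1537 * K + e :=  -- binade 2
      ⟨k + 1 - 1537 * K, by omega, by omega⟩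
    rcases Nat.mod_two_eq_zero_or_one e with hp | hp
    · refine value_step5 hq hR (n := (1024 * K + e) * 8 + 5) ?_ (by omega) ?_
      · rw [traj5N_T2 (by omega) (by omega), hek, fam5Z_B2 K e he, pairZ_even _ _ hp]
        push_cast; omega
      · rw [traj5N_T2 (by omega) (by omega), rneSigMag_binade_step (j := 2) hM h2 (by norm_num)
          (by omega) (by norm_num)]
        simp [stepUp]; omega
    · refine value_step5 hq hR (n := (1024 * K + e) * 8 + 4) ?_ (by omega) ?_
      · rw [traj5N_T2 (by omega) (by omega), hek, fam5Z_B2 K e he, pairZ_odd _ _ hp]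
        push_cast; omega
      · rw [traj5N_T2 (by omega) (by omega), rneSigMag_binade_step (j := 2) hM h2 (by norm_num)
          (by omega) (by norm_num)]
        simp [stepUp]; omega
  · obtain ⟨e, he, hek⟩ : ∃ e, e < 1024 * K ∧ k + 1 = 2561 * K + e :=  -- binade 3
      ⟨k + 1 - 2561 * K, by omega, by omega⟩
    rcases Nat.mod_two_eq_zero_or_one e with hp | hp
    · refine value_step5 hq hR (n := (1024 * K + e) * 16 + 9) ?_ (by omega) ?_
      · rw [traj5N_T3 (by omega) (by omega), hek, fam5Z_B3 K e he, pairZ_even _ _ hp]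
        push_cast; omega
      · rw [traj5N_T3 (by omega) (by omega), rneSigMag_binade_step (j := 3) hM h2 (by norm_num)
          (by omega) (by norm_num)]
        simp [stepUp]; omega
    · refine value_step5 hq hR (n := (1024 * K + e) * 16 + 8) ?_ (by omega) ?_
      · rw [traj5N_T3 (by omega) (by omega), hek, fam5Z_B3 K e he, pairZ_odd _ _ hp]
        push_cast; omega
      · rw [traj5N_T3 (by omega) (by omega), rneSigMag_binade_step (j := 3) hM h2 (by norm_num)
          (by omega) (by norm_num)]
        simp [stepUp]; omega
  · obtain ⟨e, he, hek⟩ : ∃ e, e < 1024 * K ∧ k + 1 = 3585 * K + e :=  -- binade 4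
      ⟨k + 1 - 3585 * K, by omega, by omega⟩
    rcases Nat.mod_two_eq_zero_or_one e with hp | hp
    · refine value_step5 hq hR (n := (1024 * K + e) * 32 + 18) ?_ (by omega) ?_
      · rw [traj5N_T4 (by omega) (by omega), hek, fam5Z_B4 K e he, pairZ_even _ _ hp]
        push_cast; omega
      · rw [traj5N_T4 (by omega) (by omega), rneSigMag_binade_step (j := 4) hM h2 (by norm_num)
          (by omega) (by norm_num)]
        simp [stepUp]; omega
    · refine value_step5 hq hR (n := (1024 * K + e) * 32 + 16) ?_ (by omega) ?_
      · rw [traj5N_T4 (by omega) (by omega), hek, fam5Z_B4 K e he, pairZ_odd _ _ hp]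
        push_cast; omega
      · rw [traj5N_T4 (by omega) (by omega), rneSigMag_binade_step (j := 4) hM h2 (by norm_num)
          (by omega) (by norm_num)]
        simp [stepUp]; omega
  · obtain ⟨e, he, hek⟩ : ∃ e, e < 1024 * K ∧ k + 1 = 4609 * K + e :=  -- binade 5
      ⟨k + 1 - 4609 * K, by omega, by omega⟩
    rcases Nat.mod_two_eq_zero_or_one e with hp | hp
    · refine value_step5 hq hR (n := (1024 * K + e) * 64 + 36) ?_ (by omega) ?_
      · rw [traj5N_T5 (by omega) (by omega), hek, fam5Z_B5 K e he, pairZ_even _ _ hp]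
        push_cast; omega
      · rw [traj5N_T5 (by omega) (by omega), rneSigMag_binade_step (j := 5) hM h2 (by norm_num)
          (by omega) (by norm_num)]
        simp [stepUp]; omega
    · refine value_step5 hq hR (n := (1024 * K + e) * 64 + 32) ?_ (by omega) ?_
      · rw [traj5N_T5 (by omega) (by omega), hek, fam5Z_B5 K e he, pairZ_odd _ _ hp]
        push_cast; omega
      · rw [traj5N_T5 (by omega) (by omega), rneSigMag_binade_step (j := 5) hM h2 (by norm_num)
          (by omega) (by norm_num)]
        simp [stepUp]; omega
  · obtain ⟨e, he, hek⟩ : ∃ e, e < 1024 * K ∧ k + 1 = 5633 * K + e :=  -- binade 6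
      ⟨k + 1 - 5633 * K, by omega, by omega⟩
    rcases Nat.mod_two_eq_zero_or_one e with hp | hp
    · refine value_step5 hq hR (n := (1024 * K + e) * 128 + 72) ?_ (by omega) ?_
      · rw [traj5N_T6 (by omega) (by omega), hek, fam5Z_B6 K e he, pairZ_even _ _ hp]
        push_cast; omega
      · rw [traj5N_T6 (by omega) (by omega), rneSigMag_binade_step (j := 6) hM h2 (by norm_num)
          (by omega) (by norm_num)]
        simp [stepUp]; omega
    · refine value_step5 hq hR (n := (1024 * K + e) * 128 + 64) ?_ (by omega) ?_
      · rw [traj5N_T6 (by omega) (by omega), hek, fam5Z_B6 K e he, pairZ_odd _ _ hp]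
        push_cast; omega
      · rw [traj5N_T6 (by omega) (by omega), rneSigMag_binade_step (j := 6) hM h2 (by norm_num)
          (by omega) (by norm_num)]
        simp [stepUp]; omega
  · obtain ⟨e, he, hek⟩ : ∃ e, e < 1024 * K ∧ k + 1 = 6657 * K + e :=  -- binade 7
      ⟨k + 1 - 6657 * K, by omega, by omega⟩
    rcases Nat.mod_two_eq_zero_or_one e with hp | hp
    · refine value_step5 hq hR (n := (1024 * K + e) * 256 + 144) ?_ (by omega) ?_
      · rw [traj5N_T7 (by omega) (by omega), hek, fam5Z_B7 K e he, pairZ_even _ _ hp]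
        push_cast; omega
      · rw [traj5N_T7 (by omega) (by omega), rneSigMag_binade_step (j := 7) hM h2 (by norm_num)
          (by omega) (by norm_num)]
        simp [stepUp]; omega
    · refine value_step5 hq hR (n := (1024 * K + e) * 256 + 128) ?_ (by omega) ?_
      · rw [traj5N_T7 (by omega) (by omega), hek, fam5Z_B7 K e he, pairZ_odd _ _ hp]
        push_cast; omega
      · rw [traj5N_T7 (by omega) (by omega), rneSigMag_binade_step (j := 7) hM h2 (by norm_num)
          (by omega) (by norm_num)]
        simp [stepUp]; omega
  · obtain ⟨e, he, hek⟩ : ∃ e, e < 1024 * K ∧ k + 1 = 7681 * K + e :=  -- binade 8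
      ⟨k + 1 - 7681 * K, by omega, by omega⟩
    rcases Nat.mod_two_eq_zero_or_one e with hp | hp
    · refine value_step5 hq hR (n := (1024 * K + e) * 512 + 288) ?_ (by omega) ?_
      · rw [traj5N_T8 (by omega) (by omega), hek, fam5Z_B8 K e he, pairZ_even _ _ hp]
        push_cast; omega
      · rw [traj5N_T8 (by omega) (by omega), rneSigMag_binade_step (j := 8) hM h2 (by norm_num)
          (by omega) (by norm_num)]
        simp [stepUp]; omega
    · refine value_step5 hq hR (n := (1024 * K + e) * 512 + 256) ?_ (by omega) ?_
      · rw [traj5N_T8 (by omega) (by omega), hek, fam5Z_B8 K e he, pairZ_odd _ _ hp]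
        push_cast; omega
      · rw [traj5N_T8 (by omega) (by omega), rneSigMag_binade_step (j := 8) hM h2 (by norm_num)
          (by omega) (by norm_num)]
        simp [stepUp]; omega
  · obtain ⟨e, he, hek⟩ : ∃ e, e < 1024 * K ∧ k + 1 = 8705 * K + e :=  -- binade 9
      ⟨k + 1 - 8705 * K, by omega, by omega⟩
    rcases Nat.mod_two_eq_zero_or_one e with hp | hp
    · refine value_step5 hq hR (n := (1024 * K + e) * 1024 + 576) ?_ (by omega) ?_
      · rw [traj5N_T9 (by omega) (by omega), hek, fam5Z_B9 K e he, pairZ_even _ _ hp]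
        push_cast; omega
      · rw [traj5N_T9 (by omega) (by omega), rneSigMag_binade_step (j := 9) hM h2 (by norm_num)
          (by omega) (by norm_num)]
        simp [stepUp]; omega
    · refine value_step5 hq hR (n := (1024 * K + e) * 1024 + 512) ?_ (by omega) ?_
      · rw [traj5N_T9 (by omega) (by omega), hek, fam5Z_B9 K e he, pairZ_odd _ _ hp]
        push_cast; omega
      · rw [traj5N_T9 (by omega) (by omega), rneSigMag_binade_step (j := 9) hM h2 (by norm_num)
          (by omega) (by norm_num)]
        simp [stepUp]; omega
  · obtain ⟨e, he, hek⟩ : ∃ e, e < 1024 * K ∧ k + 1 = 9729 * K + e :=  -- binade 10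
      ⟨k + 1 - 9729 * K, by omega, by omega⟩
    rcases Nat.mod_two_eq_zero_or_one e with hp | hp
    · refine value_step5 hq hR (n := (1024 * K + e) * 2048 + 1152) ?_ (by omega) ?_
      · rw [traj5N_T10 (by omega) (by omega), hek, fam5Z_B10 K e he, pairZ_even _ _ hp]
        push_cast; omega
      · rw [traj5N_T10 (by omega) (by omega), rneSigMag_binade_step (j := 10) hM h2 (by norm_num)
          (by omega) (by norm_num)]
        simp [stepUp]; omega
    · refine value_step5 hq hR (n := (1024 * K + e) * 2048 + 1024) ?_ (by omega) ?_
      · rw [traj5N_T10 (by omega) (by omega), hek, fam5Z_B10 K e he, pairZ_odd _ _ hp]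
        push_cast; omega
      · rw [traj5N_T10 (by omega) (by omega), rneSigMag_binade_step (j := 10) hM h2 (by norm_num)
          (by omega) (by norm_num)]
        simp [stepUp]; omega
  · obtain ⟨e, he, hek⟩ : ∃ e, e < 2 ∧ k + 1 = 10753 * K + e :=  -- binade 11
      ⟨k + 1 - 10753 * K, by omega, by omega⟩
    rcases Nat.mod_two_eq_zero_or_one e with hp | hp
    · refine value_step5 hq hR (n := (1024 * K + e) * 4096 + 2304) ?_ (by omega) ?_
      · rw [traj5N_T11 (by omega) (by omega), hek, fam5Z_B11 K e he, pairZ_even _ _ hp]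
        push_cast; omega
      · rw [traj5N_T11 (by omega) (by omega), rneSigMag_binade_step (j := 11) hM h2 (by norm_num)
          (by omega) (by norm_num)]
        simp [stepUp]; omega
    · refine value_step5 hq hR (n := (1024 * K + e) * 4096 + 2048) ?_ (by omega) ?_
      · rw [traj5N_T11 (by omega) (by omega), hek, fam5Z_B11 K e he, pairZ_odd _ _ hp]
        push_cast; omega
      · rw [traj5N_T11 (by omega) (by omega), rneSigMag_binade_step (j := 11) hM h2 (by norm_num)
          (by omega) (by norm_num)]
        simp [stepUp]; omega

/-- THE ABSORBED TAIL: at `v° = 131072K + 256` the letter `-64` gives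
`v° - 64 = (1024K+1)·128 + 64`, a tie at an odd point, which rounds back up to the even `v°`.
[cell, gemm.tex Thm. t:thetapmix] -/
theorem tail_fix5 :
    (roundNE φ ((131072 * (K : ℚ) + 256) + (-64))).toRat = 131072 * (K : ℚ) + 256 ∧
      |(131072 * (K : ℚ) + 256) + (-64)| ≤ φ.maxRat := by
  obtain ⟨hK1, hpow, -⟩ := pow_facts5 hM
  have h2 : 2 ∣ 1024 * K := ⟨512 * K, by ring⟩
  have h := value_step5 hq hR (a := 4194304 * K + 8192) (c := -2048)
    (n := (1024 * K + 1) * 4096 + 2048) (b := 4194304 * K + 8192) (by push_cast; omega)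
    (by omega)
    (by rw [rneSigMag_binade_step (j := 11) hM h2 (by norm_num) (by omega) (by norm_num)]
        simp [stepUp]; omega)
  have e1 : ((4194304 * K + 8192 : ℕ) : ℚ) / 32 + ((-2048 : ℤ) : ℚ) / 32
      = (131072 * (K : ℚ) + 256) + (-64) := by
    push_cast; ring
  have e2 : ((4194304 * K + 8192 : ℕ) : ℚ) / 32 = 131072 * (K : ℚ) + 256 := by push_cast; ring
  rw [e1, e2] at h
  exact h

/-- `ŝ₀ = 64` (for `K = 1` the first letter is `2^(m+1)` itself). [cell] -/
theorem fam5_s0 : (seqSum φ (fam5 K) 0).toRat = traj5 K 0 := by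
  obtain ⟨hK1, hpow, hpow1⟩ := pow_facts5 hM
  show (roundNE φ (fam5 K 0)).toRat = traj5 K 0
  unfold fam5 traj5
  rw [fam5Z_P (by omega), traj5N_P (by omega)]
  have hr : rneSigMag φ.manBits 2048 = 2048 := by
    rcases Nat.lt_or_ge 2048 (2 ^ (φ.manBits + 1)) with h | h
    · exact rneSigMag_of_lt h
    · have hK : K = 1 := by rw [hpow1] at h; omega
      subst hK
      have h' := rneSigMag_binade_step (t := 0) (r := 0) (j := 0) (u := 2) hM ⟨512, rfl⟩
        (by norm_num) (by norm_num) (by norm_num)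
      simpa [stepUp] using h'
  have h := roundNE_grid5_nat hq hR (n := 2048) (by omega)
  rw [hr] at h
  push_cast at h ⊢
  simpa using h

/-- THE ACCUMULATOR FOLLOWS `traj5` ALONG THE WHOLE PREFIX. [cell] -/
theorem fam5_seqSum : ∀ k ≤ 10753 * K + 1, (seqSum φ (fam5 K) k).toRat = traj5 K k := by
  intro k hk
  have h := seqSum_orbitFn (α := φ) (fam5 K) 0 (10753 * K + 1) (fun j => fam5 K (j + 1)) (traj5 K)
    (fun j _ => by rw [Nat.zero_add]) (fam5_s0 hq hR hM)
    (fun j hj => (traj5_step hq hR hM j hj).1) k hk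
  rwa [Nat.zero_add] at h

/-- The prefix stays in range. [cell] -/
theorem fam5_inRange_prefix : InRange φ (fam5 K) (10753 * K + 1) := by
  obtain ⟨hK1, hpow, -⟩ := pow_facts5 hM
  refine ⟨?_, fun k hk => ?_⟩
  · unfold fam5; rw [fam5Z_P (by omega), abs_of_nonneg (by positivity)]
    exact le_trans (by norm_num) (grid5_le_maxRat hR (n := 2048) (by omega))
  · rw [fam5_seqSum hq hR hM k (le_of_lt hk)]
    exact (traj5_step hq hR hM k hk).2

end Steps

/-! ### The closed form for every length `n ≥ 10753K + 2` -/

section Closed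

variable (hq : φ.qexp ≤ -5) (hR : (2 : ℚ) ^ (φ.manBits + 15) ≤ φ.maxRat)
  {K : ℕ} (hM : 2 ^ φ.manBits = 1024 * K)
include hq hR hM

/-- FOR EVERY `k ≥ 10753K + 1`: `ŝₖ = 131072K + 256`,
`Σ = (2230272K + 4352)/32 - 64(k - 10753K - 1)`, `Σ|·| = (2230272K + 4352)/32 + 64(k - 10753K - 1)`.
[cell] -/
theorem fam5_tail : ∀ k, 10753 * K + 1 ≤ k →
    (seqSum φ (fam5 K) k).toRat = 131072 * (K : ℚ) + 256 ∧
    ∑ i ∈ range (k + 1), fam5 K i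
      = (2230272 * (K : ℚ) + 4352) / 32 + ((k : ℚ) - (10753 * K + 1 : ℕ)) * (-64) ∧
    ∑ i ∈ range (k + 1), |fam5 K i|
      = (2230272 * (K : ℚ) + 4352) / 32 + ((k : ℚ) - (10753 * K + 1 : ℕ)) * 64 := by
  obtain ⟨hK1, hpow, -⟩ := pow_facts5 hM
  have hx : ∀ k, 10753 * K + 1 < k → fam5 K k = -64 := by
    intro k hk; unfold fam5; rw [fam5Z_tail (by omega)]; norm_num
  have hS : ∑ i ∈ range (10753 * K + 1 + 1), fam5 K i = (2230272 * (K : ℚ) + 4352) / 32 := by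
    have h' : ((∑ k ∈ range (10753 * K + 2), fam5Z K k : ℤ) : ℚ)
        = ((2230272 * K + 4352 : ℤ) : ℚ) := by
      rw [sum_fam5Z K]
    push_cast at h'
    unfold fam5
    simp_rw [div_eq_mul_inv]
    rw [← sum_mul, show 10753 * K + 1 + 1 = 10753 * K + 2 by omega, h']
  have hΛ : ∑ i ∈ range (10753 * K + 1 + 1), |fam5 K i|
      = (2230272 * (K : ℚ) + 4352) / 32 := by
    rw [← hS]
    refine sum_congr rfl (fun i hi => abs_of_pos ?_)
    unfold fam5
    have := (fam5Z_mem_pos K i).2 (by have := mem_range.mp hi; omega)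
    have : (0 : ℚ) < fam5Z K i := by exact_mod_cast this
    positivity
  have hv : (seqSum φ (fam5 K) (10753 * K + 1)).toRat = 131072 * (K : ℚ) + 256 := by
    rw [fam5_seqSum hq hR hM _ le_rfl]; unfold traj5; rw [traj5N_F le_rfl]; push_cast; ring
  have h := tieChain_spec (α := φ) (fam5 K) (10753 * K + 1) (-64) (131072 * (K : ℚ) + 256) _ _
    hx hv (tail_fix5 hq hR hM).1 hS hΛ
  intro k hk
  obtain ⟨h1, h2, h3⟩ := h k hk
  refine ⟨h1, by simpa using h2, by rw [h3, abs_of_neg (by norm_num)]; push_cast; ring⟩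

/-- The family never leaves the finite range of `φ`. [cell] -/
theorem fam5_inRange : ∀ k, InRange φ (fam5 K) k := by
  refine tieChain_inRange (α := φ) (fam5 K) (10753 * K + 1) (-64) (131072 * (K : ℚ) + 256)
    (fun k hk => by unfold fam5; rw [fam5Z_tail (by omega)]; norm_num) ?_ (tail_fix5 hq hR hM).1
    (fam5_inRange_prefix hq hR hM) (tail_fix5 hq hR hM).2
  rw [fam5_seqSum hq hR hM _ le_rfl]; unfold traj5; rw [traj5N_F le_rfl]; push_cast; ring

/-- THE CLOSED FORM: for every length `n = k + 1 ≥ 10753K + 2` the relative error of the family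
is `(8n - 78352K - 1)/(8n - 77312K + 1)`. [cell, gemm.tex Thm. t:thetapmix] -/
theorem fam5_relErr (k : ℕ) (hk : 10753 * K + 1 ≤ k) :
    |(seqSum φ (fam5 K) k).toRat - ∑ i ∈ range (k + 1), fam5 K i|
        / ∑ i ∈ range (k + 1), |fam5 K i|
      = (8 * ((k : ℚ) + 1) - 78352 * K - 1) / (8 * ((k : ℚ) + 1) - 77312 * K + 1) := by
  obtain ⟨h1, h2, h3⟩ := fam5_tail hq hR hM k hk
  have hk' : ((10753 * K + 1 : ℕ) : ℚ) ≤ k := by exact_mod_cast hk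
  have hK0 : (0 : ℚ) ≤ K := Nat.cast_nonneg K
  rw [h1, h2, h3]
  push_cast at hk' ⊢
  have hd1 : (0 : ℚ) <
      (2230272 * (K : ℚ) + 4352) / 32 + ((k : ℚ) - (10753 * (K : ℚ) + 1)) * 64 := by
    nlinarith
  have hd2 : (0 : ℚ) < 8 * ((k : ℚ) + 1) - 77312 * K + 1 := by nlinarith
  rw [abs_of_nonneg (by nlinarith), div_eq_div_iff hd1.ne' hd2.ne']
  ring

/-- Equivalently `1 - (relative error) = (1040K + 2)/(8n - 77312K + 1)` — the numerator is
`8·θ_p`. [cell, gemm.tex Thm. t:thetapmix] -/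
theorem fam5_defect (k : ℕ) (hk : 10753 * K + 1 ≤ k) :
    1 - |(seqSum φ (fam5 K) k).toRat - ∑ i ∈ range (k + 1), fam5 K i|
        / ∑ i ∈ range (k + 1), |fam5 K i|
      = (1040 * (K : ℚ) + 2) / (8 * ((k : ℚ) + 1) - 77312 * K + 1) := by
  rw [fam5_relErr hq hR hM k hk]
  have hk' : ((10753 * K + 1 : ℕ) : ℚ) ≤ k := by exact_mod_cast hk
  push_cast at hk'
  have hden : (8 * ((k : ℚ) + 1) - 77312 * K + 1) ≠ 0 := by
    have : (0 : ℚ) ≤ K := Nat.cast_nonneg K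
    exact (by nlinarith : (0 : ℚ) < 8 * ((k : ℚ) + 1) - 77312 * K + 1).ne'
  rw [eq_div_iff hden, sub_mul, div_mul_cancel₀ _ hden]
  ring

end Closed

end Summit.Ventures.CertifiedArithmetic.LowPrec.Gemm
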